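import Mathlib

/-!
# Fubini for the base change of a tensor product of bilinear forms

Blind re-derivation cell `pub-hodge-repro`, seat `night-3` (gen 2).  Mathlib only.  Namespace `HodgeRepro.Night3.WeilModel`.

`Night3WeilModelProduct` takes «Fubini on the lines» as a hypothesis: `Q_{a+b}(ℓ_σ, ℓ_τ) = ε · Q_a(ℓ_σ, ℓ_τ) · Q_b(ℓ_σ, ℓ_τ)`
(LEMMA-L-P-v2.md step (2): «`Q′(w′_σ, w′_τ) = ± ∏_i E_i(w_σ^{(i)}, w_τ^{(i)})` (Künneth / Fubini, up to the sign of the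
reordering)»).  In a model where the form on `B_a × B_b` is the tensor product of the forms on the factors (read through the
Künneth map), that hypothesis follows from the linear algebra proved here: for rational forms `Q₁`, `Q₂` on `K`-spaces
`X₁`, `X₂`, the base change of `Q₁ ⊗ Q₂` to `L`, evaluated on tensors of the complexified factors read in
`L ⊗[K] (X₁ ⊗[K] X₂)` through `distribBaseChange⁻¹`, is the product of the base-changed factor forms:

* `tmul_apply_tmul` — typer-2's «Fubini» on pure tensors (candidate `LemmaPProduct.tmul_apply_tmul`, f74894530183540a,
  re-stated with attribution);
* `baseChange_tmul_distribBaseChange_symm` — **Fubini under base change**: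
  `(Q₁ ⊗ Q₂)_L (dBC⁻¹ (x₁ ⊗ x₂)) (dBC⁻¹ (y₁ ⊗ y₂)) = (Q₁)_L x₁ y₁ * (Q₂)_L x₂ y₂` for all `x₁, y₁ ∈ L ⊗ X₁`,
  `x₂, y₂ ∈ L ⊗ X₂` (four tensor inductions; the pure-tensor case is a `ring` identity).

Nothing here closes S4; no sealed file is touched; no Tier-2 item depends on this file.
-/

set_option autoImplicit false

open TensorProduct

namespace HodgeRepro.Night3.WeilModel

section Tmul

variable {R : Type*} [CommRing R] {V₁ V₂ : Type*} [AddCommGroup V₁] [Module R V₁] [AddCommGroup V₂] [Module R V₂]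

/-- «Fubini»: the tensor product of two bilinear forms on pure tensors,
`(B₁ ⊗ B₂)(x₁ ⊗ x₂, y₁ ⊗ y₂) = B₁ x₁ y₁ * B₂ x₂ y₂`.  (typer-2, LemmaPProduct `tmul_apply_tmul`, re-stated.) -/
theorem tmul_apply_tmul (B₁ : LinearMap.BilinForm R V₁) (B₂ : LinearMap.BilinForm R V₂)
    (x₁ y₁ : V₁) (x₂ y₂ : V₂) :
    (B₁.tmul B₂) (x₁ ⊗ₜ[R] x₂) (y₁ ⊗ₜ[R] y₂) = B₁ x₁ y₁ * B₂ x₂ y₂ := by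
  change LinearMap.BilinForm.tensorDistrib R R (B₁ ⊗ₜ[R] B₂) (x₁ ⊗ₜ[R] x₂) (y₁ ⊗ₜ[R] y₂) = _
  rw [LinearMap.BilinForm.tensorDistrib_tmul, smul_eq_mul, mul_comm]

end Tmul

section BaseChange

variable {K L : Type*} [Field K] [Field L] [Algebra K L]
variable {X₁ X₂ : Type*} [AddCommGroup X₁] [Module K X₁] [AddCommGroup X₂] [Module K X₂]

/-- The identification `distribBaseChange⁻¹` on pure tensors (typer-2, LemmaPKunneth `distribBaseChange_symm_tmul`,
re-stated): `(a ⊗ w₁) ⊗ (b ⊗ w₂) ↦ (b * a) ⊗ (w₁ ⊗ w₂)`. -/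
theorem distribBaseChange_symm_tmul' (a b : L) (w₁ : X₁) (w₂ : X₂) :
    (AlgebraTensorModule.distribBaseChange K L X₁ X₂).symm ((a ⊗ₜ[K] w₁) ⊗ₜ[L] (b ⊗ₜ[K] w₂)) =
      (b * a) ⊗ₜ[K] (w₁ ⊗ₜ[K] w₂) := by
  simp only [AlgebraTensorModule.distribBaseChange, LinearEquiv.symm_symm, LinearEquiv.trans_apply,
    AlgebraTensorModule.cancelBaseChange_tmul, smul_tmul', smul_eq_mul, AlgebraTensorModule.assoc_tmul]

/-- **Fubini under base change**: the base change of `Q₁ ⊗ Q₂`, on tensors of the complexified factors read through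
`distribBaseChange⁻¹`, is the product of the base-changed factor forms. -/
theorem baseChange_tmul_distribBaseChange_symm (Q₁ : LinearMap.BilinForm K X₁) (Q₂ : LinearMap.BilinForm K X₂)
    (x₁ y₁ : L ⊗[K] X₁) (x₂ y₂ : L ⊗[K] X₂) :
    LinearMap.BilinForm.baseChange L (Q₁.tmul Q₂) ((AlgebraTensorModule.distribBaseChange K L X₁ X₂).symm (x₁ ⊗ₜ[L] x₂))
        ((AlgebraTensorModule.distribBaseChange K L X₁ X₂).symm (y₁ ⊗ₜ[L] y₂)) =
      (Q₁.baseChange L) x₁ y₁ * (Q₂.baseChange L) x₂ y₂ := by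
  induction x₁ using TensorProduct.induction_on with
  | zero => simp
  | add u v hu hv =>
    simp only [TensorProduct.add_tmul, map_add, LinearMap.add_apply, hu, hv, add_mul]
  | tmul a w₁ =>
    induction x₂ using TensorProduct.induction_on with
    | zero => simp
    | add u v hu hv =>
      simp only [TensorProduct.tmul_add, map_add, LinearMap.add_apply, hu, hv, mul_add]
    | tmul b w₂ =>
      induction y₁ using TensorProduct.induction_on with
      | zero => simp
      | add u v hu hv =>
        simp only [TensorProduct.add_tmul, map_add, hu, hv, add_mul]
      | tmul c v₁ =>
        induction y₂ using TensorProduct.induction_on with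
        | zero => simp
        | add u v hu hv =>
          simp only [TensorProduct.tmul_add, map_add, hu, hv, mul_add]
        | tmul d v₂ =>
          simp only [distribBaseChange_symm_tmul', LinearMap.BilinForm.baseChange_tmul, tmul_apply_tmul,
            map_mul, Algebra.smul_def]
          ring

end BaseChange

end HodgeRepro.Night3.WeilModel
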